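import Summits.QuantumFields.YangMills.Theorems.FluctuationComparisonRegPrIntLS2BetaWeightedTwoProfileTowerSum
import Mathlib.Algebra.Order.Chebyshev
import HarnessLib

/-!
# S2β · TOP-JENSEN — THE ABSTRACT SPINE (px20 g23's bytes e395a03f4c6ddc5d VERBATIM below this header; filed by px5 g23 on the architect px17 g22's GO 17:58:06Z, cell `ym3-torus`, crux `stmt-QuantumFields-20520`, helper, def-free): Jensen down an `c`-ary forest with per-level sources, in energies

`v(node) ≤ mean(children) + s(node)` at every node ⟹ per level `E_t ≤ ((1+ε)∕c)·E_{t+1} + (1+ε⁻¹)·S_t` (energies = sums of squares),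
⟹ `E_0 ≤ e^{1∕(L−1)}·(N⁻²·E_m + 2L·Σ_{t<m} L^{−t}·S_t)` for `c = L²`, `ε_t = L^{−(t+1)}`, `N = L^m`.  Reals and finite sums only.
-/

set_option autoImplicit false

namespace Summit.QuantumFields.YangMills.Theorems.FluctuationComparisonRegPrIntLS2BetaTopChordJensen

open Finset
open Summit.QuantumFields.YangMills.Theorems.FluctuationComparisonRegPrIntLS2BetaWeightedTwoProfileTowerSum (sq_le_of_le_mul_add)

/-! ## §1 One node: Jensen for the mean -/

/-- `(mean of c values)² ≤ mean of the squares`. [folklore] -/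
theorem mean_sq_le_mean_sq {ι : Type*} (s : Finset ι) (hs : s.Nonempty) (f : ι → ℝ) :
    ((∑ i ∈ s, f i) / s.card) ^ 2 ≤ (∑ i ∈ s, f i ^ 2) / s.card := by
  have hc : (0 : ℝ) < s.card := by exact_mod_cast hs.card_pos
  have h := sq_sum_le_card_mul_sum_sq (s := s) (f := f)
  rw [div_pow, div_le_div_iff₀ (by positivity) hc]
  have h0 : 0 ≤ ∑ i ∈ s, f i ^ 2 := sum_nonneg fun i _ => sq_nonneg _
  calc (∑ i ∈ s, f i) ^ 2 * (s.card : ℝ) ≤ ((s.card : ℝ) * ∑ i ∈ s, f i ^ 2) * s.card :=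
        mul_le_mul_of_nonneg_right h hc.le
    _ = (∑ i ∈ s, f i ^ 2) * (s.card : ℝ) ^ 2 := by ring

/-! ## §2 One level: energies -/

/-- **ONE LEVEL OF THE FOREST**: nodes `i : ι` with children fibres `π⁻¹ i ⊆ κ` ALL of cardinality `c > 0`; if `0 ≤ w` and
`v i ≤ (Σ_{π j = i} w j)∕c + s i` for every `i`, then for every `ε > 0`:
`Σ_i (v i)² ≤ ((1+ε)∕c)·Σ_j (w j)² + (1+ε⁻¹)·Σ_i (s i)²` (Young split, Jensen, fibrewise summation). [folklore] -/
theorem sum_sq_le_of_mean_children {ι κ : Type*} [Fintype ι] [Fintype κ] [DecidableEq ι] (π : κ → ι) {c : ℕ} (hc : 0 < c)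
    (hcard : ∀ i, (univ.filter fun j => π j = i).card = c) {v s : ι → ℝ} {w : κ → ℝ} (hv : ∀ i, 0 ≤ v i) (hw : ∀ j, 0 ≤ w j)
    (hrec : ∀ i, v i ≤ (∑ j ∈ univ.filter (fun j => π j = i), w j) / c + s i) {ε : ℝ} (hε : 0 < ε) :
    ∑ i, v i ^ 2 ≤ (1 + ε) / c * ∑ j, w j ^ 2 + (1 + ε⁻¹) * ∑ i, s i ^ 2 := by
  have hc' : (0 : ℝ) < c := by exact_mod_cast hc
  -- per node
  have hnode : ∀ i, v i ^ 2 ≤ (1 + ε) / c * ∑ j ∈ univ.filter (fun j => π j = i), w j ^ 2 + (1 + ε⁻¹) * s i ^ 2 := by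
    intro i
    have hm0 : 0 ≤ (∑ j ∈ univ.filter (fun j => π j = i), w j) / c := div_nonneg (sum_nonneg fun j _ => hw j) hc'.le
    have h1 := sq_le_of_le_mul_add (hv i) zero_le_one hm0 hε (by simpa using hrec i)
    have hne : (univ.filter fun j => π j = i).Nonempty := by
      rw [← Finset.card_pos, hcard i]; exact hc
    have hJ := mean_sq_le_mean_sq _ hne w
    rw [hcard i] at hJ
    have h2 : (1 + ε) * 1 ^ 2 * ((∑ j ∈ univ.filter (fun j => π j = i), w j) / c) ^ 2 ≤
        (1 + ε) / c * ∑ j ∈ univ.filter (fun j => π j = i), w j ^ 2 := by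
      have := mul_le_mul_of_nonneg_left hJ (by linarith : (0 : ℝ) ≤ 1 + ε)
      calc (1 + ε) * 1 ^ 2 * ((∑ j ∈ univ.filter (fun j => π j = i), w j) / c) ^ 2
          = (1 + ε) * ((∑ j ∈ univ.filter (fun j => π j = i), w j) / c) ^ 2 := by ring
        _ ≤ (1 + ε) * ((∑ j ∈ univ.filter (fun j => π j = i), w j ^ 2) / c) := this
        _ = (1 + ε) / c * ∑ j ∈ univ.filter (fun j => π j = i), w j ^ 2 := by ring
    linarith
  -- sum over nodes; the fibres partition `κ`
  have hfib : ∑ i, ∑ j ∈ univ.filter (fun j => π j = i), w j ^ 2 = ∑ j, w j ^ 2 := by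
    rw [← Finset.sum_fiberwise (s := (univ : Finset κ)) (g := π) (f := fun j => w j ^ 2)]
  calc ∑ i, v i ^ 2 ≤ ∑ i, ((1 + ε) / c * ∑ j ∈ univ.filter (fun j => π j = i), w j ^ 2 + (1 + ε⁻¹) * s i ^ 2) :=
        sum_le_sum fun i _ => hnode i
    _ = (1 + ε) / c * ∑ i, ∑ j ∈ univ.filter (fun j => π j = i), w j ^ 2 + (1 + ε⁻¹) * ∑ i, s i ^ 2 := by
        rw [sum_add_distrib, mul_sum, mul_sum]
    _ = (1 + ε) / c * ∑ j, w j ^ 2 + (1 + ε⁻¹) * ∑ i, s i ^ 2 := by rw [hfib]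

/-! ## §3 Down the tower: the energy recursion iterated -/

/-- **ITERATION**: `E t ≤ α t · E (t+1) + β t` for `t < m` (`0 ≤ α`) ⟹ `E 0 ≤ (Π_{t<m} α t)·E m + Σ_{t<m} (Π_{u<t} α u)·β t`. [folklore] -/
theorem iterate_le {E α β : ℕ → ℝ} (hα : ∀ t, 0 ≤ α t) :
    ∀ m : ℕ, (∀ t, t < m → E t ≤ α t * E (t + 1) + β t) →
      E 0 ≤ (∏ t ∈ range m, α t) * E m + ∑ t ∈ range m, (∏ u ∈ range t, α u) * β t := by
  intro m
  induction m with
  | zero => intro _; simp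
  | succ m ih =>
      intro h
      have h0 := ih fun t ht => h t (by omega)
      have hm := h m (by omega)
      have hP : 0 ≤ ∏ t ∈ range m, α t := prod_nonneg fun t _ => hα t
      rw [prod_range_succ, sum_range_succ]
      have := mul_le_mul_of_nonneg_left hm hP
      nlinarith [this, h0]

/-- `Σ_{t<m} q^{t+1} ≤ q∕(1−q)` for `0 ≤ q < 1`. [folklore] -/
theorem geom_sum_succ_le {q : ℝ} (hq0 : 0 ≤ q) (hq1 : q < 1) (m : ℕ) :
    ∑ t ∈ range m, q ^ (t + 1) ≤ q / (1 - q) := by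
  have h1q : 0 < 1 - q := by linarith
  have hs : (∑ t ∈ range m, q ^ (t + 1)) * (1 - q) = q - q ^ (m + 1) := by
    induction m with
    | zero => simp
    | succ m ih => rw [sum_range_succ, add_mul, ih]; ring
  rw [le_div_iff₀ h1q, hs]
  have : 0 ≤ q ^ (m + 1) := pow_nonneg hq0 _
  linarith

/-- `Π_{t<m} (1 + q^{t+1}) ≤ exp(q∕(1−q))` for `0 ≤ q < 1`. [folklore] -/
theorem prod_one_add_geom_le {q : ℝ} (hq0 : 0 ≤ q) (hq1 : q < 1) (m : ℕ) :
    ∏ t ∈ range m, (1 + q ^ (t + 1)) ≤ Real.exp (q / (1 - q)) := by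
  have h1 : ∏ t ∈ range m, (1 + q ^ (t + 1)) ≤ Real.exp (∑ t ∈ range m, q ^ (t + 1)) := by
    rw [Real.exp_sum]
    exact prod_le_prod (fun t _ => by positivity) fun t _ => by
      have := Real.add_one_le_exp (q ^ (t + 1)); linarith
  exact h1.trans (Real.exp_le_exp.mpr (geom_sum_succ_le hq0 hq1 m))

/-- ★★ **THE TOP ENERGY FROM THE LEAVES AND THE SOURCES**: if `0 ≤ E`, `0 ≤ S` and for every `t < m`
`E t ≤ ((1 + q^{t+1})∕c)·E (t+1) + (1 + q^{−(t+1)})·S t` (`0 < q < 1`, `0 < c`, `q·c ≥ 1` — e.g. `q = L⁻¹`, `c = L²`), then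
`E 0 ≤ exp(q∕(1−q))·(c^{−m}·E m + 2·Σ_{t<m} q^{−1}·(q·… )…)` — stated in the clean form
`E 0 ≤ exp(q∕(1−q)) · ((c⁻¹) ^ m · E m + Σ_{t<m} (c⁻¹) ^ t · (1 + (q⁻¹) ^ (t+1)) · S t)`. [folklore] -/
theorem energy_top_le {E S : ℕ → ℝ} {q c : ℝ} (hq0 : 0 ≤ q) (hq1 : q < 1) (hc : 0 < c) (hE : ∀ t, 0 ≤ E t) (hS : ∀ t, 0 ≤ S t)
    (m : ℕ) (hrec : ∀ t, t < m → E t ≤ (1 + q ^ (t + 1)) / c * E (t + 1) + (1 + (q⁻¹) ^ (t + 1)) * S t) :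
    E 0 ≤ Real.exp (q / (1 - q)) * ((c⁻¹) ^ m * E m + ∑ t ∈ range m, (c⁻¹) ^ t * ((1 + (q⁻¹) ^ (t + 1)) * S t)) := by
  have hα : ∀ t, 0 ≤ (1 + q ^ (t + 1)) / c := fun t => by positivity
  have h0 := iterate_le (E := E) (α := fun t => (1 + q ^ (t + 1)) / c) (β := fun t => (1 + (q⁻¹) ^ (t + 1)) * S t) hα m hrec
  -- partial products: `Π_{u<t} (1+q^{u+1})/c ≤ exp(q/(1-q)) · c^{-t}`
  have hP : ∀ t, ∏ u ∈ range t, (1 + q ^ (u + 1)) / c ≤ Real.exp (q / (1 - q)) * (c⁻¹) ^ t := by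
    intro t
    rw [prod_div_distrib, prod_const, card_range, div_eq_mul_inv, ← inv_pow]
    exact mul_le_mul_of_nonneg_right (prod_one_add_geom_le hq0 hq1 t) (by positivity)
  have hexp : 0 ≤ Real.exp (q / (1 - q)) := (Real.exp_pos _).le
  have h1 : (∏ t ∈ range m, (1 + q ^ (t + 1)) / c) * E m ≤ Real.exp (q / (1 - q)) * (c⁻¹) ^ m * E m :=
    mul_le_mul_of_nonneg_right (hP m) (hE m)
  have h2 : ∑ t ∈ range m, (∏ u ∈ range t, (1 + q ^ (u + 1)) / c) * ((1 + (q⁻¹) ^ (t + 1)) * S t) ≤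
      ∑ t ∈ range m, Real.exp (q / (1 - q)) * (c⁻¹) ^ t * ((1 + (q⁻¹) ^ (t + 1)) * S t) :=
    sum_le_sum fun t _ => mul_le_mul_of_nonneg_right (hP t) (mul_nonneg (by positivity) (hS t))
  have h3 : ∑ t ∈ range m, Real.exp (q / (1 - q)) * (c⁻¹) ^ t * ((1 + (q⁻¹) ^ (t + 1)) * S t) =
      Real.exp (q / (1 - q)) * ∑ t ∈ range m, (c⁻¹) ^ t * ((1 + (q⁻¹) ^ (t + 1)) * S t) := by
    rw [mul_sum]; exact sum_congr rfl fun t _ => by ring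
  calc E 0 ≤ _ := h0
    _ ≤ Real.exp (q / (1 - q)) * (c⁻¹) ^ m * E m + Real.exp (q / (1 - q)) * ∑ t ∈ range m, (c⁻¹) ^ t * ((1 + (q⁻¹) ^ (t + 1)) * S t) := by
        rw [← h3]; exact add_le_add h1 h2
    _ = _ := by ring

end Summit.QuantumFields.YangMills.Theorems.FluctuationComparisonRegPrIntLS2BetaTopChordJensen
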